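import Summits.AtomisticToContinuum.Crystallization.Theses.SquareWellLayerCake
import Literature.MathematicalPhysics.StatisticalMechanics.LennardJonesClusters
import Literature.MathematicalPhysics.StatisticalMechanics.BarlowStackingEnergy
import Summits.AtomisticToContinuum.Crystallization.Theses.PoissonBesselStacking
import Summits.AtomisticToContinuum.Crystallization.Theorems.MinMeanCycleStackingLockLockedBoxMinimiserLayerSums
import Summits.AtomisticToContinuum.Crystallization.Theorems.SquareWellLayerCakeStackingFaultSparsityDefs
import Summits.AtomisticToContinuum.Crystallization.Theorems.SquareWellLayerCakeStackingFaultSparsitySubwindow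
import Summits.AtomisticToContinuum.Crystallization.Theorems.SquareWellLayerCakeStackingFaultSparsityWindowToHcp
import Summits.AtomisticToContinuum.Crystallization.Theorems.SquareWellLayerCakeStackingFaultSparsityChainBlockFlip
import Summits.AtomisticToContinuum.Crystallization.Theorems.SquareWellLayerCakeStackingFaultSparsityCovering
import Summits.AtomisticToContinuum.Crystallization.Theorems.SquareWellLayerCakeStackingFaultSparsityFarPaste
import Summits.AtomisticToContinuum.Crystallization.Theorems.SquareWellLayerCakeStackingFaultSparsityCompetitorInjective
import Summits.AtomisticToContinuum.Crystallization.Theorems.SquareWellLayerCakeStackingFaultSparsityDiluteAssembly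
import Summits.AtomisticToContinuum.Crystallization.Theorems.SquareWellLayerCakeStackingFaultSparsityPerturbativeTransfer
import Summits.AtomisticToContinuum.Crystallization.Theorems.SquareWellLayerCakeStackingFaultSparsityExactLatticeLedger
import Summits.AtomisticToContinuum.Crystallization.Theorems.SquareWellLayerCakeStackingFaultSparsityUniformGainOnBox
import Summits.AtomisticToContinuum.Crystallization.Theorems.SquareWellLayerCakeStackingFaultSparsityOffBoxDefs
import Summits.AtomisticToContinuum.Crystallization.Theorems.SquareWellLayerCakeStackingFaultSparsityOffBoxLayerCert
import Summits.AtomisticToContinuum.Crystallization.Theorems.SquareWellLayerCakeStackingFaultSparsityOffBoxFarLayers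
import Summits.AtomisticToContinuum.Crystallization.Theorems.SquareWellLayerCakeStackingFaultSparsityOffBoxIdentities
import Summits.AtomisticToContinuum.Crystallization.Theorems.SquareWellLayerCakeStackingFaultSparsityOffBoxReduction
import Summits.AtomisticToContinuum.Crystallization.Theorems.SquareWellLayerCakeStackingFaultSparsityOffBoxRef
import Summits.AtomisticToContinuum.Crystallization.Theorems.SquareWellLayerCakeStackingFaultSparsityOffBoxGridOf
import Summits.AtomisticToContinuum.Crystallization.Theorems.FrustrationRangeCertificatesCertificatesDefectVanish
import Summits.AtomisticToContinuum.Crystallization.Theorems.BrittleRungDescentRungAssembly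

/-!
# `StackingFaultSparsity` from `LaminarBarlowWindows` (the line `Sketch` closed modulo X)

The checked line `Sketch` of crux stmt-AtomisticToContinuum-14296 (`Cruxes/StackingFaultSparsity/Lines/Sketch.lean`)
proves the crux `StackingFaultSparsity` (shared by the routes `SquareWellLayerCake` and `LaminarSixThreeThree`, same
term) from registered stubs, ALL of which have landed under `Theorems/SquareWellLayerCakeStackingFaultSparsity*.lean`
except the X-type input `stub_coarsening` (= `FaultedGrainCoarsening`: particles with a faulted `(R,ε)`-window but no
`(L,ε')`-Barlow window have density `→ 0`), whose unconditional form is the open problem stmt-AtomisticToContinuum-14292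
and which follows from `LaminarBarlowWindows` by monotonicity of `Nat.card`.  This file is that composition with the
X-type stub replaced by the hypothesis `LaminarBarlowWindows`:

* `StackingFaultSparsity_of_laminarBarlowWindows : LaminarBarlowWindows → StackingFaultSparsity` (route
  `SquareWellLayerCake`, where `LaminarBarlowWindows` is derived from the cruxes K1–K3 inside `closes`), and the same
  term for the sibling route `LaminarSixThreeThree` (whose TARGET is `LaminarBarlowWindows`).

Ingredients (all landed): the geometric/combinatorial stubs `stub_windowToHcp`, `stub_subwindow`, `stub_covering`,
the dilute-faults chain `stub_chainBlockFlip`, `stub_competitorInjective`, `stub_exactLatticeLedger`,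
`stub_perturbativeTransfer`, `stub_diluteAssembly`, the uniform gain `stub_uniformGainOnBox` (item 3063), the far paste
`stub_farPaste`, and the certified off-box scale gap (`stub_offBoxIdentities/LayerCert/FarLayers/Reduction/Ref/Grid`:
116 kernel certificates of the interval checker `obCheck`).  All `[folklore]` glue; the mathematics is in the cited files.
-/

noncomputable section

open scoped BigOperators Topology
open Filter
open Literature.MathematicalPhysics.StatisticalMechanics
open Summit.AtomisticToContinuum.Crystallization.Theorems.SquareWellLayerCake.StackingFaultSparsity
open Summit.AtomisticToContinuum.Crystallization.Theorems.LockedBoxMinimiser (continuousOn_barlowCoupling)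
open Summit.AtomisticToContinuum.Crystallization.Theorems.ExcessDecayLiouvilleCoarseGrains
  (hcpSumTerm hcpSumLoopI hcpSumQ)

namespace Summit.AtomisticToContinuum.Crystallization.Theorems.SquareWellLayerCake.StackingFaultSparsity.OfLaminarBarlowWindows

/-! ## Elementary glue (proved; `Nat.card` monotonicity and the eventual squeeze are the landed
`BrittleRungDescentRungAssembly.natCard_subtype_le_of_imp` / `certificatesDefectVanish_tendsto_zero`) -/

/-- Union bound for `Nat.card` of subtypes of `Fin N`. -/
theorem natCard_le_add {N : ℕ} {P Q₁ Q₂ : Fin N → Prop} (hPQ : ∀ i, P i → Q₁ i ∨ Q₂ i) :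
    Nat.card {i : Fin N // P i} ≤ Nat.card {i : Fin N // Q₁ i} + Nat.card {i : Fin N // Q₂ i} := by
  classical
  rw [Nat.card_eq_fintype_card, Nat.card_eq_fintype_card, Nat.card_eq_fintype_card,
    Fintype.card_subtype, Fintype.card_subtype, Fintype.card_subtype]
  calc (Finset.univ.filter fun i : Fin N => P i).card
      ≤ ((Finset.univ.filter fun i : Fin N => Q₁ i) ∪ (Finset.univ.filter fun i : Fin N => Q₂ i)).card := by
        refine Finset.card_le_card fun i hi => ?_
        simp only [Finset.mem_filter, Finset.mem_univ, true_and, Finset.mem_union] at hi ⊢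
        exact hPQ i hi
    _ ≤ _ := Finset.card_union_le _ _

/-- Squeeze: a smaller subtype has smaller density, so density `→ 0` transfers. -/
theorem tendsto_density_mono {P Q : (N : ℕ) → Fin N → Prop} (hPQ : ∀ N i, P N i → Q N i)
    (hQ : Tendsto (fun N : ℕ => (Nat.card {i : Fin N // Q N i} : ℝ) / N) atTop (𝓝 0)) :
    Tendsto (fun N : ℕ => (Nat.card {i : Fin N // P N i} : ℝ) / N) atTop (𝓝 0) := by
  refine squeeze_zero (fun N => by positivity) (fun N => ?_) hQ
  refine div_le_div_of_nonneg_right ?_ (Nat.cast_nonneg N)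
  exact_mod_cast
    Summit.AtomisticToContinuum.Crystallization.Theorems.BrittleRungDescentRungAssembly.natCard_subtype_le_of_imp
      (hPQ N)

/-! ## Stub 1 — the X-type input (coarsening of faulted grains)

`FaultedGrainCoarsening` of `IdeatorOneSketch`, verbatim: particles with a faulted `(R,ε)`-window but NO
`(L,ε')`-Barlow window have density `→ 0`, for every `(L, ε')`.  Implied by X = `LaminarBarlowWindows`
(stmt-AtomisticToContinuum-14292, the target of LaminarSixThreeThree; derived from K1–K3 inside `closes`
of SquareWellLayerCake) by `coarsening_of_laminarBarlowWindows` below, and by the crux itself; its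
unconditional form is open (bounded faulted Barlow grains floating in a non-Barlow bulk, refuter note S1). -/

/-- The X-conditional closure of stub 1 (proved): `LaminarBarlowWindows` implies it. -/
theorem coarsening_of_laminarBarlowWindows
    (hX : Summit.AtomisticToContinuum.Crystallization.Theses.SquareWellLayerCake.LaminarBarlowWindows) :
    ∀ R ε L ε' : ℝ, 0 < R → 0 < ε → ε < 1 / 4 → 0 < L → 0 < ε' → ε' < 1 / 4 →
    ∀ x : (N : ℕ) → (Fin N → EuclideanSpace ℝ (Fin 3)), (∀ N, IsGroundState lennardJones (x N)) →
      Tendsto (fun N : ℕ =>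
        (Nat.card {i : Fin N // (BarlowM R ε (x N) i ∧ ¬ HcpM R ε (x N) i) ∧ ¬ BarlowM L ε' (x N) i} : ℝ) / N)
        atTop (𝓝 0) := by
  intro R ε L ε' _ _ _ hL hε' hε'4 x hx
  exact tendsto_density_mono (fun N i hi => hi.2) (hX L ε' hL hε' hε'4 x hx)

/-! ## Stub 5 — dilute faults (card A's `DiluteFaults`), RESHAPED (reshape 4) into 5c–5f along the survey map

The finite-`N` transfer of the Shockley slab restacking, numerics-free (survey `DiluteFaultsSurvey.md`,
typed in `Lines/DiluteFaultsSurvey.lean`; competitor vocabulary `shiftSign`/`latSq`/`InCyl`/`blockShift`/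
`latticeShift`/`changedPairSum` LANDED in the Defs file, p130688): (5c) the block-shift competitor is
INJECTIVE; (5d) the EXACT-LATTICE LEDGER of the finite disc block flip; (5e) the PERTURBATIVE TRANSFER
matched window ↔ exact lattice shadow; (5f) the ASSEMBLY (pigeonhole front end `exists_four_close_cubic`,
window enumeration `exists_enum_window`, chain facts, uniform gain, ground-state sign
`changedPairSum_nonneg_of_isGroundState`, parameter choice `ρ = L/4`, `K = ⌈√L⌉`, `ε₁ ~ 1/L`).
`stub_diluteFaults` (the former registered stub, chain facts → uniform gain → DiluteFaults) is PROVED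
below from 5c–5f. -/

/-- **The former stub `stub_diluteFaults`** (chain facts → uniform gain → DiluteFaults), now a theorem
from 5c–5f. -/
theorem stub_diluteFaults :
    (∀ (s : ℤ → ℤ) (q : Fin 4 → ℤ), StrictMono q →
      ∃ i j : Fin 4, q i < q j ∧ (3 : ℤ) ∣ haggLabel s (q j) - haggLabel s (q i)) ∧
    (∀ (s : ℤ → ℤ) (q₁ q₂ : ℤ), IsHaggSeq s → q₁ < q₂ → s q₁ = s (q₁ - 1) → s q₂ = s (q₂ - 1) →
      ∀ m : ℤ,
        ((fun n : ℤ => if q₁ ≤ n ∧ n < q₂ then -s n else s n) (m + 1) =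
            (fun n : ℤ => if q₁ ≤ n ∧ n < q₂ then -s n else s n) m) ↔
          (s (m + 1) = s m ∧ m ≠ q₁ - 1 ∧ m ≠ q₂ - 1)) ∧
    (∀ (K : ℕ) (J : ℕ → ℝ) (s : ℤ → ℤ) (q₁ q₂ m : ℤ), (m + K < q₁ ∨ q₂ ≤ m) →
      haggLocalEnergyTrunc K J (fun n : ℤ => if q₁ ≤ n ∧ n < q₂ then -s n else s n) m =
        haggLocalEnergyTrunc K J s m) ∧
    (∀ (K : ℕ) (J : ℕ → ℝ) (s : ℤ → ℤ) (q₁ q₂ : ℤ), IsHaggSeq s → q₁ < q₂ →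
      (3 : ℤ) ∣ haggLabel s q₂ - haggLabel s q₁ → s q₁ = s (q₁ - 1) → s q₂ = s (q₂ - 1) → 2 ≤ K →
      ∑ m ∈ Finset.Icc (q₁ - K) q₂,
          (haggLocalEnergyTrunc K J (fun n : ℤ => if q₁ ≤ n ∧ n < q₂ then -s n else s n) m -
            haggLocalEnergyTrunc K J s m) ≤
        2 * J 2 + 2 * ∑ k ∈ Finset.Icc 3 K, ((k : ℝ) - 1) * |J k|) →
    (∃ κ : ℝ, 0 < κ ∧ ∀ a h : ℝ, InBox a h → ∀ K : ℕ, 2 ≤ K →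
      2 * barlowCoupling lennardJones a h 2 +
          2 * ∑ k ∈ Finset.Icc 3 K, ((k : ℝ) - 1) * |barlowCoupling lennardJones a h k| ≤ -κ) →
    ∃ (M₀ : ℕ) (L₀ : ℝ), ∀ L : ℝ, L₀ ≤ L → ∃ ε₁ : ℝ, 0 < ε₁ ∧
      ∀ (N : ℕ) (x : Fin N → EuclideanSpace ℝ (Fin 3)), IsGroundState lennardJones x →
        ∀ (i : Fin N) (a h : ℝ) (s : ℤ → ℤ) (k i₀ j₀ : ℤ) (A : EuclideanSpace ℝ (Fin 3) →ₗᵢ[ℝ] EuclideanSpace ℝ (Fin 3)), InBox a h →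
          IsHaggSeq s → TwoWay (barlowStacking a h s) L ε₁ x i (barlowPos a h s k i₀ j₀) A →
          (cubicNear s k ⌊L / (2 * h)⌋₊).card ≤ M₀ :=
  stub_diluteAssembly stub_competitorInjective stub_exactLatticeLedger stub_perturbativeTransfer

/-! ## Stub 6 — scale pinning (physics; card A's `ScalePinning`), RESHAPED (cycle 1) into 6a + 6b

Wave-1 triage (stub-worker, `work/stubs/ScalePinning.lean` + `ScalePinning-notes.md` in the lead
folder) found the statement sound (the LJ basin `(a*, h*/a*) = (0.9712, 0.8165)` is interior to the
box with energy margins `≥ 5.4e-3` at the box boundary; matching slop, degenerate/interpenetrating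
parameters and small `N` are all harmless) and typed the two facts the far-paste mechanism needs;
`scalePinning_of_gap_farPaste` below is their sorry-free reduction.  The lead registers them as the
two stubs replacing `stub_scalePinning`. -/

/-! ### Stub 6a — the off-box scale gap, RESHAPED (lead c1) into six stubs over the certified
per-layer lattice sums (`Theorems/SquareWellLayerCakeStackingFaultSparsityOffBoxDefs.lean`)

`W(a,h) = e₀(a,h) - ∑_{k≥2}|J_k(a,h)| ≥ (a¹²)⁻¹/12 · offBoxA 12 (h/a) - (a⁶)⁻¹/6 · offBoxB 12 (h/a)`
(`stub_offBoxIdentities` + `stub_offBoxLayerCert` + `stub_offBoxFarLayers` ⇒ `stub_offBoxReduction`), the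
right-hand side is `≥ -717/1000` off the box by the kernel-checked grid (`stub_offBoxGrid`: 116 intervals
of `obCheck`, `decide +kernel`, ≈ 10 s each), and `e(hcp 0.9713 0.79296932) ≤ -7175/10000`
(`stub_offBoxRef`, the certified grid point `hcpSum_grid_8164`); `γ = 1/2000`. -/

/-- **The former stub `stub_offBoxScaleGap`** (now a theorem from 6a's six stubs): some in-box relaxed hcp
`hcp(a₀,h₀)` (`a₀ = 0.9713`, `h₀ = 0.8164·a₀`) and `γ = 1/2000 > 0` such that for every OFF-box
`(a, h) ∈ (1/2,2)²` the word-free lower bound `e₀(a,h) - ∑_{k ≥ 2} |J_k(a,h)|` of the energy per particle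
of every Barlow stacking with these parameters exceeds `e(hcp a₀ h₀)` by `γ` (measured infimum `5.0e-3` at
the top edge `h = 17a/20`, `a ≈ 0.96`). -/
theorem stub_offBoxScaleGap :
    ∃ (a₀ h₀ : ℝ) (ha₀ : a₀ ≠ 0) (hh₀ : h₀ ≠ 0) (γ : ℝ), 0 < γ ∧
      ∀ a h : ℝ, 1 / 2 < a → a < 2 → 1 / 2 < h → h < 2 → ¬ InBox a h →
        (hcpPeriodicConfiguration ha₀ hh₀).energyPerParticle lennardJones + γ ≤
          barlowBaseEnergy lennardJones a h - ∑' k : ℕ, |barlowCoupling lennardJones a h (k + 2)| := by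
  refine ⟨9713 / 10000, 9713 / 10000 * (8164 / 10000), by norm_num, by norm_num, 1 / 2000,
    by norm_num, ?_⟩
  intro a h ha1 ha2 hh1 hh2 hbox
  have ha : 0 < a := by linarith
  have hh : 0 < h := by linarith
  have hred := stub_offBoxReduction stub_offBoxIdentities stub_offBoxLayerCert.2
    (stub_offBoxFarLayers stub_offBoxLayerCert.2) a h ha hh
  have hc : a * (h / a) = h := by field_simp
  have hgrid := stub_offBoxGrid a (h / a) ha1 ha2 (by rw [hc]; exact hh1) (by rw [hc]; exact hh2)
    (by rw [hc]; exact hbox)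
  have href := stub_offBoxRef (by norm_num) (by norm_num)
  linarith

/-- **Scale pinning from the two stubs (sorry-free; the wave-1 triage worker's reduction):** take
`Q = hcp(a₀, h₀)` and `η = γ/2` in the far-paste; an off-box matched window would then satisfy
`e(Q) + γ ≤ e₀ - ∑|J| ≤ e(Q) + γ/2`.  This is the former registered `stub_scalePinning`, verbatim. -/
theorem scalePinning_of_gap_farPaste :
    ∃ (L₁ ε₁ : ℝ), 0 < ε₁ ∧ ∀ L : ℝ, L₁ ≤ L →
      ∀ (N : ℕ) (x : Fin N → EuclideanSpace ℝ (Fin 3)), IsGroundState lennardJones x →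
        ∀ (i : Fin N) (a h : ℝ) (s : ℤ → ℤ) (z : EuclideanSpace ℝ (Fin 3)) (A : EuclideanSpace ℝ (Fin 3) →ₗᵢ[ℝ] EuclideanSpace ℝ (Fin 3)), 1 / 2 < a → a < 2 →
          1 / 2 < h → h < 2 → IsHaggSeq s → z ∈ barlowStacking a h s →
          TwoWay (barlowStacking a h s) L ε₁ x i z A → InBox a h := by
  obtain ⟨a₀, h₀, ha₀, hh₀, γ, hγ, hgap⟩ := stub_offBoxScaleGap
  obtain ⟨L₁, ε₁, hε₁, hfp⟩ := stub_farPaste (hcpPeriodicConfiguration ha₀ hh₀) (γ / 2) (by positivity)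
  refine ⟨L₁, ε₁, hε₁, fun L hL N x hx i a h s z A ha1 ha2 hh1 hh2 hs hz hTW => ?_⟩
  by_contra hbox
  have h1' := hgap a h ha1 ha2 hh1 hh2 hbox
  have h2' := hfp L hL N x hx i a h s z A ha1 ha2 hh1 hh2 hs hz hTW
  linarith

/-! ## Composition: the stub STATEMENTS prove the crux BY NAME (sorry-free) -/

/-- **Selection at a fixed large scale** (sorry-free from stubs 4–6 and the proved minimal distance):
for every `R, ε` there is `C` such that for every large `L` there is a tolerance `ε' ∈ (0, ε/2]`, below
`1/8`, at which, for EVERY `N` and every ground state, the particles with an `(L, ε')`-Barlow window but no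
`(R, ε)`-hcp window number at most `C N / L`. -/
theorem selection_count (R ε : ℝ) (hR : 0 < R) (hε : 0 < ε) (hε4 : ε < 1 / 4) :
    ∃ C : ℝ, 0 ≤ C ∧ ∃ L₂ : ℝ, ∀ L : ℝ, L₂ ≤ L → 0 < L → ∃ ε' : ℝ, 0 < ε' ∧ ε' ≤ ε / 2 ∧
      ∀ (N : ℕ) (x : Fin N → EuclideanSpace ℝ (Fin 3)), IsGroundState lennardJones x →
        (Nat.card {i : Fin N // BarlowM L ε' x i ∧ ¬ HcpM R ε x i} : ℝ) ≤ C * N / L := by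
  obtain ⟨M₀, L₀, hdil⟩ := stub_diluteFaults stub_chainBlockFlip stub_uniformGainOnBox
  obtain ⟨L₁, ε₁, hε₁, hpin⟩ := scalePinning_of_gap_farPaste
  obtain ⟨d₀, hd₀, hsep⟩ := LennardJonesMinimalDistance_holds
  -- the layer range fed to `stub_windowToHcp`
  set M : ℕ := ⌈2 * (R + 1)⌉₊ with hMdef
  have hM : 2 * (R + 1) ≤ (M : ℝ) := Nat.le_ceil _
  obtain ⟨C, hC0, hcov⟩ := stub_covering stub_windowToHcp stub_subwindow M₀ M R ε d₀ hR hε hε4 hd₀ hM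
  refine ⟨C, hC0, max L₀ L₁, fun L hL hLpos => ?_⟩
  have hL₀ : L₀ ≤ L := (le_max_left _ _).trans hL
  have hL₁ : L₁ ≤ L := (le_max_right _ _).trans hL
  obtain ⟨ε₂, hε₂, hdilL⟩ := hdil L hL₀
  -- the working tolerance
  set ε' : ℝ := min (min ε₂ ε₁) (min (ε / 2) (d₀ / 8)) with hε'def
  have hε'pos : 0 < ε' := by positivity
  have hε'₂ : ε' ≤ ε₂ := (min_le_left _ _).trans (min_le_left _ _)
  have hε'₁ : ε' ≤ ε₁ := (min_le_left _ _).trans (min_le_right _ _)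
  have hε'ε : ε' ≤ ε / 2 := (min_le_right _ _).trans (min_le_left _ _)
  have hε'd : ε' ≤ d₀ / 8 := (min_le_right _ _).trans (min_le_right _ _)
  refine ⟨ε', hε'pos, hε'ε, fun N x hx => ?_⟩
  refine hcov L ε' hLpos hε'pos (by linarith) (by linarith) N x (hsep N x hx) ?_ ?_
  · intro i a h s k i₀ j₀ A hbox hs hTW
    exact hdilL N x hx i a h s k i₀ j₀ A hbox hs (hTW.mono le_rfl hε'₂)
  · intro i a h s z A ha1 ha2 hh1 hh2 hs hz hTW
    exact hpin L hL₁ N x hx i a h s z A ha1 ha2 hh1 hh2 hs hz (hTW.mono le_rfl hε'₁)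

/-- **The crux from `LaminarBarlowWindows`** (all other stubs landed): split the bad set at scale
`(L, ε')`, bound the coarse part by `stub_coarsening` and the selection part by `selection_count`,
get `limsup ≤ C / L` for every large `L`, hence `→ 0`. -/
theorem crux_of_laminarBarlowWindows
    (hX : Summit.AtomisticToContinuum.Crystallization.Theses.SquareWellLayerCake.LaminarBarlowWindows) :
    Summit.AtomisticToContinuum.Crystallization.Theses.SquareWellLayerCake.StackingFaultSparsity := by
  intro R ε hR hε hε4 x hx
  obtain ⟨C, hC0, L₂, hsel⟩ := selection_count R ε hR hε hε4
  refine Summit.AtomisticToContinuum.Crystallization.Theorems.certificatesDefectVanish_tendsto_zero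
    (fun N => by positivity) fun η hη => ?_
  -- choose the scale: `C / L ≤ η / 2`
  set L : ℝ := max (max L₂ 1) (2 * C / η) with hLdef
  have hL₂ : L₂ ≤ L := (le_max_left _ _).trans (le_max_left _ _)
  have hL1 : (1 : ℝ) ≤ L := (le_max_right _ _).trans (le_max_left _ _)
  have hLpos : 0 < L := by linarith
  have hCL : C / L ≤ η / 2 := by
    rw [div_le_iff₀ hLpos]
    have : 2 * C / η ≤ L := le_max_right _ _
    rw [div_le_iff₀ hη] at this
    linarith
  obtain ⟨ε', hε'pos, hε'le, hcount⟩ := hsel L hL₂ hLpos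
  have hε'4 : ε' < 1 / 4 := by linarith
  -- the coarse part
  have hco := coarsening_of_laminarBarlowWindows hX R ε L ε' hR hε hε4 hLpos hε'pos hε'4 x hx
  have hco' : ∀ᶠ N : ℕ in atTop,
      (Nat.card {i : Fin N // (BarlowM R ε (x N) i ∧ ¬ HcpM R ε (x N) i) ∧ ¬ BarlowM L ε' (x N) i} : ℝ)
        / N ≤ η / 2 :=
    (hco.eventually (Iic_mem_nhds (show (0 : ℝ) < η / 2 by positivity))).mono fun N hN => hN
  filter_upwards [hco', eventually_gt_atTop 0] with N hN hNpos
  have hNr : (0 : ℝ) < N := by exact_mod_cast hNpos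
  -- the split of the bad set
  have hsplit : (Nat.card {i : Fin N // BarlowM R ε (x N) i ∧ ¬ HcpM R ε (x N) i} : ℝ) ≤
      (Nat.card {i : Fin N // (BarlowM R ε (x N) i ∧ ¬ HcpM R ε (x N) i) ∧ ¬ BarlowM L ε' (x N) i} : ℝ)
        + (Nat.card {i : Fin N // BarlowM L ε' (x N) i ∧ ¬ HcpM R ε (x N) i} : ℝ) := by
    exact_mod_cast natCard_le_add (N := N)
      (P := fun i => BarlowM R ε (x N) i ∧ ¬ HcpM R ε (x N) i)
      (Q₁ := fun i => (BarlowM R ε (x N) i ∧ ¬ HcpM R ε (x N) i) ∧ ¬ BarlowM L ε' (x N) i)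
      (Q₂ := fun i => BarlowM L ε' (x N) i ∧ ¬ HcpM R ε (x N) i)
      (fun i hi => by
        by_cases hB : BarlowM L ε' (x N) i
        · exact Or.inr ⟨hB, hi.2⟩
        · exact Or.inl ⟨hi, hB⟩)
  have hsel' : (Nat.card {i : Fin N // BarlowM L ε' (x N) i ∧ ¬ HcpM R ε (x N) i} : ℝ) / N ≤ η / 2 := by
    have h1 := hcount N (x N) (hx N)
    rw [div_le_iff₀ hNr]
    have h2 : C * N / L = (C / L) * N := by ring
    rw [h2] at h1
    have h3 : (C / L) * N ≤ (η / 2) * N := mul_le_mul_of_nonneg_right hCL hNr.le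
    linarith
  calc (Nat.card {i : Fin N // BarlowM R ε (x N) i ∧ ¬ HcpM R ε (x N) i} : ℝ) / N
      ≤ (Nat.card {i : Fin N // (BarlowM R ε (x N) i ∧ ¬ HcpM R ε (x N) i) ∧ ¬ BarlowM L ε' (x N) i} : ℝ)
          / N + (Nat.card {i : Fin N // BarlowM L ε' (x N) i ∧ ¬ HcpM R ε (x N) i} : ℝ) / N := by
        rw [← add_div]; exact div_le_div_of_nonneg_right hsplit hNr.le
    _ ≤ η / 2 + η / 2 := add_le_add hN hsel'
    _ = η := by ring

/-- **`LaminarBarlowWindows → StackingFaultSparsity`** (route `SquareWellLayerCake`): the crux of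
stmt-AtomisticToContinuum-14296 from the X-type input alone — every other stub of the checked line `Sketch` has
landed. [folklore] -/
theorem StackingFaultSparsity_of_laminarBarlowWindows :
    Summit.AtomisticToContinuum.Crystallization.Theses.SquareWellLayerCake.LaminarBarlowWindows →
      Summit.AtomisticToContinuum.Crystallization.Theses.SquareWellLayerCake.StackingFaultSparsity :=
  crux_of_laminarBarlowWindows

/-- **`LaminarBarlowWindows → StackingFaultSparsity`** for the sibling route `LaminarSixThreeThree` (the same
terms: its TARGET `LaminarBarlowWindows` implies its rank-5 crux). [folklore] -/
theorem StackingFaultSparsity_of_laminarBarlowWindows' :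
    Summit.AtomisticToContinuum.Crystallization.Theses.LaminarSixThreeThree.LaminarBarlowWindows →
      Summit.AtomisticToContinuum.Crystallization.Theses.LaminarSixThreeThree.StackingFaultSparsity :=
  crux_of_laminarBarlowWindows

end Summit.AtomisticToContinuum.Crystallization.Theorems.SquareWellLayerCake.StackingFaultSparsity.OfLaminarBarlowWindows

end
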